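import Literature.NumberTheory.EllipticCurves.KrizLi2019.SexticTwistBSDThree
import Literature.NumberTheory.QuadraticFields.FundamentalDiscriminant
import Literature.NumberTheory.QuadraticFields.DedekindZetaReducedForms
import HarnessLib

/-!
# Crux 3 `MazurMCOnCellB` (stmt-BirchSwinnertonDyer-19033), line `twistback` v4 — road (d) into stub 6:
# the field supply's class number IN THE DOOR'S CURRENCY — `h₃(D·d_K) = 1` (`ThreeClassNumberTrivial`) as
# `3 ∤ h(D·d_K)` (`BinaryQuadraticForm.classNumber`, the shape of w3 g7's Bernoulli-unit criterion), and the
# fundamentality of `D·d_K`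

Width seat bsd-line-x2-p1-w6 (g0), 2026-08-28. HONEST FRAMING (cell `bsd-eis`, run/shared/lean/pub/bsd-eis/): pure
quadratic-field bookkeeping, THEOREMS ONLY (no definition, no named fact, no `sorry`); nothing is booked; no main
conjecture / BSD is proved for any curve; 0 cells / labels / tiers move; no summit statement is proved by this seat.

WHY: the field supply (w6 (2), `…TwistbackKLFieldSupply.exists_heegnerField_threeClassNumberTrivial`, modulo the
Nakagawa–Horie–Taya fact) delivers `K` with `d_K ≡ 1 (mod 24·A·D)`, `d_K` odd squarefree `< −4`, and
`KrizLi2019.ThreeClassNumberTrivial (D · d_K)` ("`3 ∤ h_F` for every quadratic `F ∋ √(D·d_K)`"). The KL-flat door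
consumes the class number as `¬ 3 ∣ BinaryQuadraticForm.classNumber (−d)` for the conductor `d = D·|d_K|` of the
carrier's odd quadratic character (w3 g7 `…TwistbackPartnerClassNumberLift.norm_twistedBernoulli_teichmullerLift_inv_eq_one_iff_three`,
through LEAD g10's p645771 `klFlat_of_norm_twistedBernoulli_eq_one`). This file is the dictionary between the two:

* §1 `isFundamental_mul_of_coprime` — `D > 0` fundamental, `d ≡ 1 (mod 4)` squarefree, `gcd(d, D) = 1` ⟹ `D·d` is a
  fundamental discriminant (odd case: `≡ 1 (mod 4)` squarefree; even case `D = 4m`: `D·d = 4(m·d)`,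
  `m·d ≡ 2, 3 (mod 4)` squarefree).
* §2 `not_three_dvd_classNumber_of_threeClassNumberTrivial` — for a fundamental `δ < 0`:
  `ThreeClassNumberTrivial δ ⟹ ¬ 3 ∣ BinaryQuadraticForm.classNumber δ` (the quadratic field `K_δ` with `d_{K_δ} = δ`
  exists, tree `Quadratic.exists_numberField_discr_eq`; it contains `√δ`, tree `Quadratic.exists_sq_eq_discr`; and
  `h(δ) = h_{K_δ}`, tree `Quadratic.card_reducedForms_eq_classNumber`, Cox Thm. 7.7 (ii)).
* §3 `not_three_dvd_classNumber_mul` — the two combined at `δ = D·d`: `¬ 3 ∣ BinaryQuadraticForm.classNumber (D·d)`,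
  together with `4 < (D·d).natAbs` (the `4 < d` side condition of w3 g7's criterion) from `d < −4`, `D ≥ 1`.

References: [Cox2013] §2.A, Thm. 7.7 (ii); [Marcus2018] Ch. 2 Thm. 1; [KrizLi2019] §9 (notation `h₃`).
-/

set_option autoImplicit false

-- `Summit.BirchSwinnertonDyer.BirchSwinnertonDyer.…`: the summit and its single sub-problem share a name.
set_option linter.dupNamespace false

noncomputable section

open scoped Classical

open NumberField
  Literature.NumberTheory.EllipticCurves.KrizLi2019
  Literature.NumberTheory.QuadraticFields

namespace Summit.BirchSwinnertonDyer.BirchSwinnertonDyer.Theorems.EisensteinPrimesMazurMCOnCellBTwistbackKLFieldSupplyClassNumber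

/-! ## §1. `D·d` is a fundamental discriminant -/

/-- **The product of a positive fundamental discriminant `D` and a coprime negative odd fundamental discriminant `d`
(`d ≡ 1 (mod 4)` squarefree) is a fundamental discriminant.** Odd `D` (`≡ 1 (mod 4)` squarefree): `D·d ≡ 1 (mod 4)`
is squarefree (coprime squarefree factors, Mathlib `squarefree_mul_iff`) and `≠ 1` (it is negative). Even `D = 4m`,
`m ≡ 2, 3 (mod 4)` squarefree: `D·d = 4·(m·d)` with `m·d ≡ m·1 ≡ 2, 3 (mod 4)` squarefree. [cite: Cox2013, §2.A (fundamental discriminants)] -/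
theorem isFundamental_mul_of_coprime {D d : ℤ} (hD0 : 0 < D)
    (hDf : (D % 4 = 1 ∧ Squarefree D ∧ D ≠ 1) ∨ (4 ∣ D ∧ (D / 4 % 4 = 2 ∨ D / 4 % 4 = 3) ∧ Squarefree (D / 4)))
    (hd0 : d < 0) (hd4 : d % 4 = 1) (hdsf : Squarefree d) (hcop : IsCoprime d D) :
    (D * d % 4 = 1 ∧ Squarefree (D * d) ∧ D * d ≠ 1) ∨
      (4 ∣ D * d ∧ (D * d / 4 % 4 = 2 ∨ D * d / 4 % 4 = 3) ∧ Squarefree (D * d / 4)) := by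
  have hneg : D * d < 0 := mul_neg_of_pos_of_neg hD0 hd0
  rcases hDf with ⟨hD4, hDsf, -⟩ | ⟨h4, hm4, hmsf⟩
  · left
    refine ⟨?_, ?_, by omega⟩
    · have : D * d % 4 = (D % 4) * (d % 4) % 4 := Int.mul_emod D d 4
      rw [this, hD4, hd4]; decide
    · exact squarefree_mul_iff.mpr ⟨(hcop.symm).isRelPrime, hDsf, hdsf⟩
  · right
    obtain ⟨m, rfl⟩ := h4
    rw [Int.mul_ediv_cancel_left _ four_ne_zero] at hm4 hmsf
    have hq : 4 * m * d / 4 = m * d := by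
      rw [mul_assoc, Int.mul_ediv_cancel_left _ four_ne_zero]
    refine ⟨⟨m * d, by ring⟩, ?_, ?_⟩
    · rw [hq]
      have : m * d % 4 = (m % 4) * (d % 4) % 4 := Int.mul_emod m d 4
      rw [this, hd4]
      rcases hm4 with h | h <;> rw [h] <;> decide
    · rw [hq]
      have hcop' : IsCoprime d m :=
        IsCoprime.of_isCoprime_of_dvd_right hcop ⟨4, by ring⟩
      exact squarefree_mul_iff.mpr ⟨(hcop'.symm).isRelPrime, hmsf, hdsf⟩

/-! ## §2. `h₃(δ) = 1` (`ThreeClassNumberTrivial`) ⟹ `3 ∤ h(δ)` (`BinaryQuadraticForm.classNumber`) -/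

/-- **For a negative fundamental discriminant `δ`: `ThreeClassNumberTrivial δ ⟹ ¬ 3 ∣ h(δ)`**, `h(δ)` = the number
of reduced primitive positive definite forms of discriminant `δ` (`BinaryQuadraticForm.classNumber δ`). The quadratic
field `K_δ` with `d_{K_δ} = δ` exists (`Quadratic.exists_numberField_discr_eq`), contains a square root of `δ`
(`Quadratic.exists_sq_eq_discr`), so `3 ∤ h_{K_δ}` by the hypothesis, and `h(δ) = h_{K_δ}`
(`Quadratic.card_reducedForms_eq_classNumber`). [cite: Cox2013, Thm. 7.7 (ii)] [cite: Marcus2018, Ch. 2 Thm. 1] -/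
theorem not_three_dvd_classNumber_of_threeClassNumberTrivial {δ : ℤ} (hδ0 : δ < 0)
    (hδf : (δ % 4 = 1 ∧ Squarefree δ ∧ δ ≠ 1) ∨ (4 ∣ δ ∧ (δ / 4 % 4 = 2 ∨ δ / 4 % 4 = 3) ∧ Squarefree (δ / 4)))
    (h3 : ThreeClassNumberTrivial δ) :
    ¬ 3 ∣ BinaryQuadraticForm.classNumber δ := by
  obtain ⟨K, _, _, h2, hdisc⟩ := Quadratic.exists_numberField_discr_eq hδf
  obtain ⟨-, -, x, -, hx⟩ := Quadratic.exists_sq_eq_discr (K := K) h2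
  have hsq : ∃ y : K, y ^ 2 = (δ : K) := by
    refine ⟨(x : K), ?_⟩
    have h := congrArg (fun z : 𝓞 K ↦ (z : K)) hx
    simp only [map_pow, map_intCast] at h
    rw [hdisc] at h
    exact h
  have hK : ¬ 3 ∣ NumberField.classNumber K := h3 K h2 hsq
  rwa [← hdisc, Quadratic.card_reducedForms_eq_classNumber h2 (by rw [hdisc]; exact hδ0)]

/-! ## §3. At `δ = D·d`: the door's class-number input and its side condition -/

/-- **The field supply's class number in the door's currency.** `D > 0` fundamental, `d < −4` with `d ≡ 1 (mod 4)`
squarefree and `gcd(d, D) = 1`, and `ThreeClassNumberTrivial (D·d)` ⟹ `¬ 3 ∣ BinaryQuadraticForm.classNumber (D·d)`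
and `4 < (D·d).natAbs` — with `D·d = −(D·|d|)` these are the hypotheses `¬ 3 ∣ h(−(D|d|))`, `4 < D|d|` of w3 g7's
`norm_twistedBernoulli_teichmullerLift_inv_eq_one_iff_three` for the carrier's odd quadratic character of conductor
`D·|d|`. §1 + §2. [cite: Cox2013, Thm. 7.7 (ii)] [cite: KrizLi2019, §9 (h₃(d₀ d_K) = 1)] -/
theorem not_three_dvd_classNumber_mul {D d : ℤ} (hD0 : 0 < D)
    (hDf : (D % 4 = 1 ∧ Squarefree D ∧ D ≠ 1) ∨ (4 ∣ D ∧ (D / 4 % 4 = 2 ∨ D / 4 % 4 = 3) ∧ Squarefree (D / 4)))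
    (hd4' : d < -4) (hd4 : d % 4 = 1) (hdsf : Squarefree d) (hcop : IsCoprime d D)
    (h3 : ThreeClassNumberTrivial (D * d)) :
    ¬ 3 ∣ BinaryQuadraticForm.classNumber (D * d) ∧ 4 < (D * d).natAbs := by
  have hd0 : d < 0 := by omega
  refine ⟨not_three_dvd_classNumber_of_threeClassNumberTrivial (mul_neg_of_pos_of_neg hD0 hd0)
    (isFundamental_mul_of_coprime hD0 hDf hd0 hd4 hdsf hcop) h3, ?_⟩
  have h1 : (1 : ℤ) ≤ D := hD0
  have : (4 : ℤ) < -(D * d) := by nlinarith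
  zify
  rw [abs_of_neg (mul_neg_of_pos_of_neg hD0 hd0)]
  exact this

end Summit.BirchSwinnertonDyer.BirchSwinnertonDyer.Theorems.EisensteinPrimesMazurMCOnCellBTwistbackKLFieldSupplyClassNumber

end
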